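import Summits.QuantumFields.YangMills.Theorems.SwapVirialDeficitSectorLaplaceDefs
import HarnessLib

/-!
# (S)-road, stub S6c: THE WINDOW ARITHMETIC of the sector-000 assembly in the letters of ✓`SectorLaplaceDefs`
# (free-hands support of ⟨stmt-QuantumFields-24197⟩ `SwapVirialDeficit.SwapGluedStiffness` ∕ ⟨24194⟩ `SwapMeanActionGap`; cell ym-idea-1, assembler fcl-p3 g47)

The (S)-skeleton (HOME `fcl-p3-g47-SectorLaplaceSkeleton.lean`, LEAD g97 rulings 2026-08-31 17:34Z ∕ 17:52Z ∕ memo4 §3) produces the `h₀` clause of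
✓`SwapRing.swapGluedStiffness_of_bulk_rest_rate` from five analytic inputs, all stated in the letters `mbConst`, `mbBulk`, `bulkIntegral`, `goodIntegral`,
`chartIntegral`, `alpha` of ✓`SectorLaplaceDefs`:

* (S2i) the bulk fibred Laplace law integrated over the bulk hubs (two-sided, relative error `K L^k (V₀∕ψ₀)^k b^{−1∕2}` + an ABSOLUTE off-tube exponential);
* (S4) the bottom tails `0 ≤ 𝔐₀ − 𝔐_bulk(ψ₀,V₀) ≤ K L^k (ψ₀^κ + V₀^{−κ})·𝔐₀` and `0 < 𝔐₀`;
* (S4b) the quantitative floor `e^{−K L^k} ≤ 𝔐₀` (LEAD referee (F1); ✓`mainConst_floor_of_integrable` + S3);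
* (S5) the tip∕end∕gnomonic-end share `good − Ib ≤ K L^k (ψ₀^κ + V₀^{−κ} + b^{−κ′})·(2π∕b)^α 𝔐₀`;
* (S6a) the split `Ib ≤ good ≤ chart`, `chart − good ≤ e^{−bc∕L⁶}` (bad signs; ✓`badSign_floor`).

THIS FILE is the pure real arithmetic that turns them into the window statement (`window_arith`): choose the cut exponent `σ = 1∕(4(k+1)²)` (`k` = S2's degradation
exponent, so `σk(k+1) ≤ 1∕4`, memo4 §3), the cuts `ψ₀ = b^{−σ}`, `V₀ = b^{σ}`, the rates `θ₂ = min(1∕4, σκ)`, `θ₃ = min(1∕4, σκ₅, κ′)` and a polynomial threshold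
`K₁ L^{q₁} ≤ b`; the two absolute exponentials are absorbed into `b^{−1∕4}·(2π∕b)^{9L⁴−1}𝔐₀` by the floor S4b (`exp_absorb`: `log b ≤ 4b^{1∕4}`).
§1 scalar lemmas (`exp_absorb`, `sigma_facts`, `monomial_dom`, `bracket_le`, `threshold_facts`, `sTwo_threshold`, `offTube_exponent_le`, `badSign_exponent_le`,
`bulk_two_sided`); §2 ★★ `window_arith`.

HONEST LABEL: arithmetic glue with the analytic inputs as HYPOTHESES (the mathematics is in the stubs S2i∕S4∕S4b∕S5∕S6a, of which S4(2nd clause)∕S5 are conditional on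
one-loop determinant uniformity per LEAD 18:02Z); ⟨24197⟩ ∕ ⟨24194⟩ OPEN; ⟨24196⟩ proved elsewhere; item of record ⟨24085⟩ SubOctaveBounded aside ∕ untouched; the
Yang–Mills mass gap is NOT proved; no summit is proved by a line.  THEOREMS ONLY (0 `def`, 0 `sorry`, no instance), standard axioms.  Seat ym-line-fcl-p3 g47
(cell ym-idea-1, free hands), `--supports stmt-QuantumFields-24197`.  References: [cite: Luscher1983, §2]; [folklore].
-/

set_option autoImplicit false

noncomputable section

namespace Summit.QuantumFields.YangMills.Theorems.SwapVirialDeficit.SectorLaplace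

/-! ## §1 Scalar lemmas -/

/-- Absorbing an absolute exponential into `b^{−1∕4}·Main`: if `e ≤ E`, `0 ≤ e`, `𝔐 ≥ e^{−M}` (`M ≥ 0`) and `b^{1∕4}(4(E+1) + M) ≤ X`, then
`e^{−X} ≤ b^{−1∕4}·((2π∕b)^e·𝔐)` (`b ≥ 1`; `log b ≤ 4b^{1∕4}`). [folklore] -/
theorem exp_absorb {b e E M X 𝔐 : ℝ} (hb : 1 ≤ b) (he : 0 ≤ e) (heE : e ≤ E) (hM : 0 ≤ M) (h𝔐 : Real.exp (-M) ≤ 𝔐)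
    (hX : b ^ (1 / 4 : ℝ) * (4 * (E + 1) + M) ≤ X) :
    Real.exp (-X) ≤ b ^ (-(1 / 4 : ℝ)) * ((2 * Real.pi / b) ^ e * 𝔐) := by
  have hb0 : 0 < b := by linarith
  have hE : 0 ≤ E := he.trans heE
  -- `(2π/b)^e ≥ b^{−E}`
  have h1 : b ^ (-E) ≤ (2 * Real.pi / b) ^ e := by
    have h2 : b ^ (-E) ≤ b ^ (-e) := Real.rpow_le_rpow_of_exponent_le hb (by linarith)
    have h3 : b ^ (-e) = (1 / b) ^ e := by rw [one_div, Real.inv_rpow hb0.le, Real.rpow_neg hb0.le]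
    have h4 : (1 / b) ^ e ≤ (2 * Real.pi / b) ^ e :=
      Real.rpow_le_rpow (by positivity) (div_le_div_of_nonneg_right (by linarith [Real.pi_gt_three]) hb0.le) he
    linarith [h3.le, h3.ge]
  -- `log b ≤ 4 b^{1/4}`, so `(E + 1/4) log b + M ≤ X`
  have hlog : Real.log b ≤ 4 * b ^ (1 / 4 : ℝ) := by
    have h := Real.log_le_rpow_div hb0.le (by norm_num : (0 : ℝ) < 1 / 4)
    linarith [h]
  have hb4 : 1 ≤ b ^ (1 / 4 : ℝ) := by
    have h := Real.rpow_le_rpow_of_exponent_le hb (by norm_num : (0 : ℝ) ≤ 1 / 4)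
    rwa [Real.rpow_zero] at h
  have hlog0 : 0 ≤ Real.log b := Real.log_nonneg hb
  have hexpo : (E + 1 / 4) * Real.log b + M ≤ X := by
    have h2 : (E + 1 / 4) * Real.log b ≤ (E + 1 / 4) * (4 * b ^ (1 / 4 : ℝ)) := mul_le_mul_of_nonneg_left hlog (by linarith)
    have h3 : M ≤ M * b ^ (1 / 4 : ℝ) := le_mul_of_one_le_right hM hb4
    nlinarith [h2, h3, hX, hb4]
  -- the lower bound of the right side in exponential form
  have h5 : Real.exp (-((E + 1 / 4) * Real.log b + M)) = b ^ (-(1 / 4 : ℝ)) * (b ^ (-E) * Real.exp (-M)) := by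
    rw [Real.rpow_def_of_pos hb0, Real.rpow_def_of_pos hb0, ← Real.exp_add, ← Real.exp_add]
    congr 1; ring
  calc Real.exp (-X) ≤ Real.exp (-((E + 1 / 4) * Real.log b + M)) := Real.exp_le_exp.2 (by linarith)
    _ = b ^ (-(1 / 4 : ℝ)) * (b ^ (-E) * Real.exp (-M)) := h5
    _ ≤ b ^ (-(1 / 4 : ℝ)) * ((2 * Real.pi / b) ^ e * 𝔐) :=
        mul_le_mul_of_nonneg_left (mul_le_mul h1 h𝔐 (Real.exp_pos _).le (by positivity)) (Real.rpow_nonneg hb0.le _)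

/-- The cut exponent `σ = 1∕(4(k+1)²)`: `0 < σ ≤ 1`, `2σk ≤ 1∕4`, `4σk ≤ 1∕4`, `σk(k+1) ≤ 1∕4`. [folklore] -/
theorem sigma_facts (k : ℕ) :
    0 < 1 / (4 * ((k : ℝ) + 1) ^ 2) ∧ 1 / (4 * ((k : ℝ) + 1) ^ 2) ≤ 1 ∧ 2 * (1 / (4 * ((k : ℝ) + 1) ^ 2)) * k ≤ 1 / 4 ∧
      4 * (1 / (4 * ((k : ℝ) + 1) ^ 2)) * k ≤ 1 / 4 ∧ (1 / (4 * ((k : ℝ) + 1) ^ 2)) * k * (k + 1) ≤ 1 / 4 := by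
  have hk : (0 : ℝ) ≤ k := Nat.cast_nonneg k
  have hpos : (0 : ℝ) < 4 * ((k : ℝ) + 1) ^ 2 := by positivity
  refine ⟨by positivity, ?_, ?_, ?_, ?_⟩
  · rw [div_le_one hpos]; nlinarith
  · rw [show 2 * (1 / (4 * ((k : ℝ) + 1) ^ 2)) * k = (2 * k) / (4 * ((k : ℝ) + 1) ^ 2) by ring, div_le_iff₀ hpos]; nlinarith
  · rw [show 4 * (1 / (4 * ((k : ℝ) + 1) ^ 2)) * k = (4 * k) / (4 * ((k : ℝ) + 1) ^ 2) by ring, div_le_iff₀ hpos]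
    nlinarith [sq_nonneg ((k : ℝ) - 1)]
  · rw [show (1 / (4 * ((k : ℝ) + 1) ^ 2)) * k * (k + 1) = (k * (k + 1)) / (4 * ((k : ℝ) + 1) ^ 2) by ring, div_le_iff₀ hpos]
    nlinarith

/-- Monomial domination for `L ≥ 1`. [folklore] -/
theorem monomial_dom {K K' L : ℝ} {q q' : ℕ} (hL : 1 ≤ L) (hK : 0 ≤ K) (hKK : K ≤ K') (hq : q ≤ q') : K * L ^ q ≤ K' * L ^ q' :=
  mul_le_mul hKK (pow_le_pow_right₀ hL hq) (by positivity) (hK.trans hKK)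

/-- The bracket of `exp_absorb` with `E = 9L⁴`, `M = K₅L^{k₅}`: `4(9L⁴+1) + K₅L^{k₅} ≤ (40+K₅)·L^{4+k₅}` (`L ≥ 1`). [folklore] -/
theorem bracket_le {K₅ L : ℝ} {k₅ : ℕ} (hL1 : 1 ≤ L) (hK₅ : 0 ≤ K₅) :
    4 * (9 * L ^ 4 + 1) + K₅ * L ^ k₅ ≤ (40 + K₅) * L ^ (4 + k₅) := by
  have h1 : L ^ 4 ≤ L ^ (4 + k₅) := pow_le_pow_right₀ hL1 (by omega)
  have h2 : L ^ k₅ ≤ L ^ (4 + k₅) := pow_le_pow_right₀ hL1 (by omega)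
  have h3 : (1 : ℝ) ≤ L ^ (4 + k₅) := one_le_pow₀ hL1
  have h4 : K₅ * L ^ k₅ ≤ K₅ * L ^ (4 + k₅) := mul_le_mul_of_nonneg_left h2 hK₅
  have e : (40 + K₅) * L ^ (4 + k₅) = 40 * L ^ (4 + k₅) + K₅ * L ^ (4 + k₅) := by ring
  rw [e]; linarith only [h1, h3, h4]

/-- The window threshold `K²·L^{2q+1} ≤ b` (`K, L ≥ 1`): `b ≥ 1`, `K L^q ≤ b^{1∕2} ≤ b^{3∕4} ≤ b`, `1 ≤ b^{1∕4}`. [folklore] -/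
theorem threshold_facts {K L b : ℝ} {q : ℕ} (hK : 1 ≤ K) (hL : 1 ≤ L) (hb : K ^ 2 * L ^ (2 * q + 1) ≤ b) :
    1 ≤ b ∧ K * L ^ q ≤ b ^ (1 / 2 : ℝ) ∧ b ^ (1 / 2 : ℝ) ≤ b ^ (3 / 4 : ℝ) ∧ b ^ (3 / 4 : ℝ) ≤ b ∧ 1 ≤ b ^ (1 / 4 : ℝ) := by
  have hK0 : 0 < K := by linarith
  have hL0 : 0 < L := by linarith
  have hLq : (1 : ℝ) ≤ L ^ (2 * q + 1) := one_le_pow₀ hL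
  have hb1 : 1 ≤ b := (one_le_mul_of_one_le_of_one_le (one_le_pow₀ hK) hLq).trans hb
  have hb0 : 0 < b := by linarith
  have hP2b : (K * L ^ q) ^ 2 ≤ b := by
    have e : (K * L ^ q) ^ 2 = K ^ 2 * L ^ (2 * q) := by ring
    rw [e]
    exact (mul_le_mul_of_nonneg_left (pow_le_pow_right₀ hL (by omega)) (by positivity)).trans hb
  have hPhalf : K * L ^ q ≤ b ^ (1 / 2 : ℝ) := by
    have h := Real.rpow_le_rpow (by positivity) hP2b (by norm_num : (0 : ℝ) ≤ 1 / 2)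
    rwa [show ((K * L ^ q) ^ 2) ^ (1 / 2 : ℝ) = K * L ^ q by
      rw [← Real.sqrt_eq_rpow, Real.sqrt_sq (by positivity)]] at h
  refine ⟨hb1, hPhalf, Real.rpow_le_rpow_of_exponent_le hb1 (by norm_num), ?_, ?_⟩
  · have h := Real.rpow_le_rpow_of_exponent_le hb1 (by norm_num : (3 / 4 : ℝ) ≤ 1)
    rwa [Real.rpow_one] at h
  · have h := Real.rpow_le_rpow_of_exponent_le hb1 (by norm_num : (0 : ℝ) ≤ 1 / 4)
    rwa [Real.rpow_zero] at h

/-- The ratio of the cuts: `V₀∕ψ₀ = b^{2σ}`, so `(V₀∕ψ₀)^k = b^{2σk}`. [folklore] -/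
theorem cut_ratio_pow {b σ ψ₀ V₀ : ℝ} (hb0 : 0 < b) (hψ : ψ₀ = b ^ (-σ)) (hV : V₀ = b ^ σ) (k : ℕ) :
    (V₀ / ψ₀) ^ k = b ^ (2 * σ * k) := by
  have eVψ : V₀ / ψ₀ = b ^ (2 * σ) := by
    rw [hψ, hV, Real.rpow_neg hb0.le, div_inv_eq_mul, ← Real.rpow_add hb0]; ring_nf
  rw [eVψ, ← Real.rpow_natCast, ← Real.rpow_mul hb0.le]

/-- S2's threshold on the window: `(K₂ L^{k₂} (V₀∕ψ₀)^{k₂})² ≤ b` from `K₂² L^{2k₂} ≤ b^{3∕4}` and `4σk₂ ≤ 1∕4`. [folklore] -/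
theorem sTwo_threshold {b σ K₂ L ψ₀ V₀ : ℝ} {k₂ : ℕ} (hb1 : 1 ≤ b) (hψ : ψ₀ = b ^ (-σ)) (hV : V₀ = b ^ σ)
    (hσ4 : 4 * σ * k₂ ≤ 1 / 4) (hpiece : K₂ ^ 2 * L ^ (2 * k₂) ≤ b ^ (3 / 4 : ℝ)) :
    (K₂ * L ^ k₂ * (V₀ / ψ₀) ^ k₂) ^ 2 ≤ b := by
  have hb0 : 0 < b := by linarith
  rw [cut_ratio_pow hb0 hψ hV k₂]
  have e1 : (K₂ * L ^ k₂ * b ^ (2 * σ * k₂)) ^ 2 = K₂ ^ 2 * L ^ (2 * k₂) * b ^ (4 * σ * k₂) := by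
    rw [mul_pow, mul_pow, ← pow_mul, ← Real.rpow_natCast (b ^ (2 * σ * k₂)) 2, ← Real.rpow_mul hb0.le]
    push_cast; ring_nf
  rw [e1]
  have h1 : b ^ (4 * σ * ↑k₂) ≤ b ^ (1 / 4 : ℝ) := Real.rpow_le_rpow_of_exponent_le hb1 hσ4
  calc K₂ ^ 2 * L ^ (2 * k₂) * b ^ (4 * σ * ↑k₂) ≤ b ^ (3 / 4 : ℝ) * b ^ (1 / 4 : ℝ) :=
        mul_le_mul hpiece h1 (Real.rpow_nonneg hb0.le _) (Real.rpow_nonneg hb0.le _)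
    _ = b := by rw [← Real.rpow_add hb0]; norm_num

/-- The off-tube exponent of S2i on the window: `b^{1∕4}(4(9L⁴+1) + K₅L^{k₅}) ≤ b·(ψ₀∕(K₂L^{k₂}V₀^{k₂}))^{k₂}` from `σk₂(k₂+1) ≤ 1∕4` and
`K₂^{k₂}(40+K₅)·L^{k₂²+4+k₅} ≤ b^{1∕2}`. [folklore] -/
theorem offTube_exponent_le {b σ K₂ K₅ L ψ₀ V₀ : ℝ} {k₂ k₅ : ℕ} (hb1 : 1 ≤ b) (hL1 : 1 ≤ L) (hK₂ : 0 < K₂) (hK₅ : 0 < K₅)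
    (hψ : ψ₀ = b ^ (-σ)) (hV : V₀ = b ^ σ) (hσkk : σ * k₂ * (k₂ + 1) ≤ 1 / 4)
    (hpiece : K₂ ^ k₂ * (40 + K₅) * L ^ (k₂ * k₂ + 4 + k₅) ≤ b ^ (1 / 2 : ℝ)) :
    b ^ (1 / 4 : ℝ) * (4 * (9 * L ^ 4 + 1) + K₅ * L ^ k₅) ≤ b * (ψ₀ / (K₂ * L ^ k₂ * V₀ ^ k₂)) ^ k₂ := by
  have hb0 : 0 < b := by linarith
  have hL0 : 0 < L := by linarith
  have hbr := bracket_le (k₅ := k₅) hL1 hK₅.le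
  have hD0 : 0 < (K₂ * L ^ k₂) ^ k₂ := by positivity
  have hq : (ψ₀ / (K₂ * L ^ k₂ * V₀ ^ k₂)) ^ k₂ = (ψ₀ / V₀ ^ k₂) ^ k₂ / (K₂ * L ^ k₂) ^ k₂ := by
    rw [mul_comm (K₂ * L ^ k₂) (V₀ ^ k₂), ← div_div, div_pow]
  have e3 : b * (ψ₀ / V₀ ^ k₂) ^ k₂ = b ^ (1 - σ * k₂ * (k₂ + 1)) := by
    rw [hψ, hV, ← Real.rpow_natCast (b ^ σ) k₂, ← Real.rpow_mul hb0.le, ← Real.rpow_sub hb0,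
      ← Real.rpow_natCast _ k₂, ← Real.rpow_mul hb0.le]
    nth_rewrite 1 [← Real.rpow_one b]
    rw [← Real.rpow_add hb0]
    congr 1; ring
  have eX : b * (ψ₀ / (K₂ * L ^ k₂ * V₀ ^ k₂)) ^ k₂ = b ^ (1 - σ * k₂ * (k₂ + 1)) / (K₂ * L ^ k₂) ^ k₂ := by
    rw [hq, ← mul_div_assoc, e3]
  rw [eX, le_div_iff₀ hD0]
  have h34 : b ^ (3 / 4 : ℝ) ≤ b ^ (1 - σ * k₂ * (k₂ + 1)) := Real.rpow_le_rpow_of_exponent_le hb1 (by linarith)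
  have hDM : (4 * (9 * L ^ 4 + 1) + K₅ * L ^ k₅) * (K₂ * L ^ k₂) ^ k₂ ≤ b ^ (1 / 2 : ℝ) := by
    have e2 : (K₂ * L ^ k₂) ^ k₂ = K₂ ^ k₂ * L ^ (k₂ * k₂) := by rw [mul_pow, ← pow_mul]
    rw [e2]
    calc (4 * (9 * L ^ 4 + 1) + K₅ * L ^ k₅) * (K₂ ^ k₂ * L ^ (k₂ * k₂))
        ≤ (40 + K₅) * L ^ (4 + k₅) * (K₂ ^ k₂ * L ^ (k₂ * k₂)) := mul_le_mul_of_nonneg_right hbr (by positivity)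
      _ = K₂ ^ k₂ * (40 + K₅) * L ^ (k₂ * k₂ + 4 + k₅) := by ring
      _ ≤ b ^ (1 / 2 : ℝ) := hpiece
  calc b ^ (1 / 4 : ℝ) * (4 * (9 * L ^ 4 + 1) + K₅ * L ^ k₅) * (K₂ * L ^ k₂) ^ k₂
      ≤ b ^ (1 / 4 : ℝ) * b ^ (1 / 2 : ℝ) := by rw [mul_assoc]; exact mul_le_mul_of_nonneg_left hDM (Real.rpow_nonneg hb0.le _)
    _ = b ^ (3 / 4 : ℝ) := by rw [← Real.rpow_add hb0]; norm_num
    _ ≤ b ^ (1 - σ * k₂ * (k₂ + 1)) := h34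

/-- The bad-sign exponent of S6a on the window: `b^{1∕4}(4(9L⁴+1) + K₅L^{k₅}) ≤ b·c∕L⁶` from `((40+K₅)∕c)·L^{10+k₅} ≤ b^{3∕4}`. [folklore] -/
theorem badSign_exponent_le {b c K₅ L : ℝ} {k₅ : ℕ} (hb1 : 1 ≤ b) (hL1 : 1 ≤ L) (hK₅ : 0 < K₅) (hc : 0 < c)
    (hpiece : (40 + K₅) / c * L ^ (10 + k₅) ≤ b ^ (3 / 4 : ℝ)) :
    b ^ (1 / 4 : ℝ) * (4 * (9 * L ^ 4 + 1) + K₅ * L ^ k₅) ≤ b * (c / L ^ 6) := by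
  have hb0 : 0 < b := by linarith
  have hL0 : 0 < L := by linarith
  have hbr := bracket_le (k₅ := k₅) hL1 hK₅.le
  have hL6 : (0 : ℝ) < L ^ 6 := by positivity
  have hc0 : c ≠ 0 := hc.ne'
  rw [show b * (c / L ^ 6) = b * c / L ^ 6 by ring, le_div_iff₀ hL6]
  have h3 : (4 * (9 * L ^ 4 + 1) + K₅ * L ^ k₅) * L ^ 6 ≤ c * b ^ (3 / 4 : ℝ) := by
    calc (4 * (9 * L ^ 4 + 1) + K₅ * L ^ k₅) * L ^ 6 ≤ (40 + K₅) * L ^ (4 + k₅) * L ^ 6 :=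
          mul_le_mul_of_nonneg_right hbr (by positivity)
      _ = c * ((40 + K₅) / c * L ^ (10 + k₅)) := by field_simp; ring
      _ ≤ c * b ^ (3 / 4 : ℝ) := mul_le_mul_of_nonneg_left hpiece hc.le
  calc b ^ (1 / 4 : ℝ) * (4 * (9 * L ^ 4 + 1) + K₅ * L ^ k₅) * L ^ 6
      ≤ b ^ (1 / 4 : ℝ) * (c * b ^ (3 / 4 : ℝ)) := by rw [mul_assoc]; exact mul_le_mul_of_nonneg_left h3 (Real.rpow_nonneg hb0.le _)
    _ = b * c := by rw [mul_comm c, ← mul_assoc, ← Real.rpow_add hb0]; norm_num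

/-- The two-sided bulk bookkeeping: `|Ib − A𝔐| ≤ |Ib − A𝔐_b| + A(𝔐 − 𝔐_b) ≤ (r₁ + r₂ + D)·A𝔐` when `|Ib − A𝔐_b| ≤ r₁·A𝔐_b + X`, `X ≤ r₂·A𝔐`,
`𝔐 − 𝔐_b ≤ D·𝔐`, `𝔐_b ≤ 𝔐`, `A, r₁ ≥ 0`. [folklore] -/
theorem bulk_two_sided {Ib A 𝔐 𝔐b X r₁ r₂ D : ℝ} (hA : 0 ≤ A) (h𝔐b : 𝔐b ≤ 𝔐) (hr₁ : 0 ≤ r₁)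
    (hB : |Ib - A * 𝔐b| ≤ r₁ * (A * 𝔐b) + X) (hX : X ≤ r₂ * (A * 𝔐)) (hdef : 𝔐 - 𝔐b ≤ D * 𝔐) :
    |Ib - A * 𝔐| ≤ (r₁ + r₂ + D) * (A * 𝔐) := by
  have h4 : A * 𝔐b ≤ A * 𝔐 := mul_le_mul_of_nonneg_left h𝔐b hA
  have htri : |Ib - A * 𝔐| ≤ |Ib - A * 𝔐b| + (A * 𝔐 - A * 𝔐b) := by
    have h3 := abs_sub_le Ib (A * 𝔐b) (A * 𝔐)
    rw [abs_of_nonpos (by linarith : A * 𝔐b - A * 𝔐 ≤ 0)] at h3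
    linarith
  have h5 : A * 𝔐 - A * 𝔐b ≤ D * (A * 𝔐) := by
    have h := mul_le_mul_of_nonneg_left hdef hA
    have e1 : A * (𝔐 - 𝔐b) = A * 𝔐 - A * 𝔐b := by ring
    have e2 : A * (D * 𝔐) = D * (A * 𝔐) := by ring
    linarith [e1, e2]
  have h6 : r₁ * (A * 𝔐b) ≤ r₁ * (A * 𝔐) := mul_le_mul_of_nonneg_left h4 hr₁
  have e3 : (r₁ + r₂ + D) * (A * 𝔐) = r₁ * (A * 𝔐) + r₂ * (A * 𝔐) + D * (A * 𝔐) := by ring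
  calc |Ib - A * 𝔐| ≤ |Ib - A * 𝔐b| + (A * 𝔐 - A * 𝔐b) := htri
    _ ≤ r₁ * (A * 𝔐b) + X + D * (A * 𝔐) := add_le_add hB h5
    _ ≤ (r₁ + r₂ + D) * (A * 𝔐) := by rw [e3]; linarith only [h6, hX]

/-! ## §2 The window arithmetic -/

set_option maxHeartbeats 400000 in
/-- ★★ **S6c — THE WINDOW ARITHMETIC** (fcl-p3 g47): with `σ = 1∕(4(k+1)²)` (`k` = S2's degradation exponent; LEAD memo4 §3), `ψ₀ = b^{−σ}`, `V₀ = b^{σ}`, the inputs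
S2i, S4, S4b, S5, S6a give the `h₀` clause of ✓`swapGluedStiffness_of_bulk_rest_rate` for sector 000 — exponent `9L⁴ − 1`, main constant `mbConst L`, rates
`θ₂ = min(1∕4, σκ)`, `θ₃ = min(1∕4, min(σκ₅, κ′))` — above a polynomial threshold; the two absolute exponentials (S2's off-tube term, S6a's bad signs) are absorbed
by S4b (`exp_absorb`). [cite: Luscher1983, §2] -/
theorem window_arith
    (hS2i : ∃ K : ℝ, 0 < K ∧ ∃ k : ℕ, ∀ (L : ℕ) [NeZero L] (ψ₀ V₀ b : ℝ), 0 < ψ₀ → ψ₀ ≤ 1 → 1 ≤ V₀ →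
      (K * (L : ℝ) ^ k * (V₀ / ψ₀) ^ k) ^ 2 ≤ b →
        0 ≤ mbBulk L ψ₀ V₀ ∧
        |bulkIntegral L b ψ₀ V₀ - (2 * Real.pi / b) ^ alpha L * mbBulk L ψ₀ V₀| ≤
          K * (L : ℝ) ^ k * (V₀ / ψ₀) ^ k * b ^ (-(1 / 2 : ℝ)) * ((2 * Real.pi / b) ^ alpha L * mbBulk L ψ₀ V₀) +
            Real.exp (-(b * (ψ₀ / (K * (L : ℝ) ^ k * V₀ ^ k)) ^ k)))
    (hS4 : ∃ K : ℝ, 0 < K ∧ ∃ κ : ℝ, 0 < κ ∧ ∃ k : ℕ, ∀ (L : ℕ) [NeZero L],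
      0 < mbConst L ∧ ∀ ψ₀ V₀ : ℝ, 0 < ψ₀ → ψ₀ ≤ 1 → 1 ≤ V₀ →
        0 ≤ mbConst L - mbBulk L ψ₀ V₀ ∧ mbConst L - mbBulk L ψ₀ V₀ ≤ K * (L : ℝ) ^ k * (ψ₀ ^ κ + V₀ ^ (-κ)) * mbConst L)
    (hS4b : ∃ K : ℝ, 0 < K ∧ ∃ k : ℕ, ∀ (L : ℕ) [NeZero L], Real.exp (-(K * (L : ℝ) ^ k)) ≤ mbConst L)
    (hS5 : ∃ K : ℝ, 0 < K ∧ ∃ κ : ℝ, 0 < κ ∧ ∃ κ' : ℝ, 0 < κ' ∧ ∃ k : ℕ, ∀ (L : ℕ) [NeZero L] (ψ₀ V₀ b : ℝ),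
      0 < ψ₀ → ψ₀ ≤ 1 → 1 ≤ V₀ → K * (L : ℝ) ^ k ≤ b →
        goodIntegral L b - bulkIntegral L b ψ₀ V₀ ≤
          K * (L : ℝ) ^ k * (ψ₀ ^ κ + V₀ ^ (-κ) + b ^ (-κ')) * ((2 * Real.pi / b) ^ alpha L * mbConst L))
    (hS6a : ∃ c : ℝ, 0 < c ∧ ∀ (L : ℕ) [NeZero L] (ψ₀ V₀ b : ℝ), 0 < ψ₀ → 0 ≤ b →
      bulkIntegral L b ψ₀ V₀ ≤ goodIntegral L b ∧ goodIntegral L b ≤ chartIntegral L b ∧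
        chartIntegral L b - goodIntegral L b ≤ Real.exp (-(b * (c / (L : ℝ) ^ 6))))
    (hα : ∀ (L : ℕ) [NeZero L], alpha L = 9 * (L : ℝ) ^ 4 - 1) :
    ∃ (K₁ K₂ K₃ θ₂ θ₃ : ℝ) (q₁ q₂ q₃ L₀ : ℕ), 0 < K₁ ∧ 0 ≤ K₂ ∧ 0 ≤ K₃ ∧ 0 < θ₂ ∧ θ₂ ≤ 1 ∧ 0 < θ₃ ∧ 1 ≤ q₁ ∧ 1 ≤ L₀ ∧
      (∀ L : ℕ, L₀ ≤ L → ∀ [NeZero L], 0 < mbConst L) ∧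
      ∀ (L : ℕ) [NeZero L], L₀ ≤ L → ∀ b : ℝ, K₁ * (L : ℝ) ^ q₁ ≤ b → ∃ Ib R : ℝ,
        Ib ≤ chartIntegral L b ∧ chartIntegral L b ≤ Ib + R ∧
        |Ib - (2 * Real.pi / b) ^ (9 * (L : ℝ) ^ 4 - 1) * mbConst L| ≤ (K₂ * (L : ℝ) ^ q₂ * b ^ (-θ₂)) * ((2 * Real.pi / b) ^ (9 * (L : ℝ) ^ 4 - 1) * mbConst L) ∧
        R ≤ (K₃ * (L : ℝ) ^ q₃ * b ^ (-θ₃)) * ((2 * Real.pi / b) ^ (9 * (L : ℝ) ^ 4 - 1) * mbConst L) := by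
  obtain ⟨K₂, hK₂, k₂, h2⟩ := hS2i
  obtain ⟨K₄, hK₄, κ, hκ, k₄, h4⟩ := hS4
  obtain ⟨K₅, hK₅, k₅, h4b⟩ := hS4b
  obtain ⟨K₃, hK₃, κ₃, hκ₃, κ', hκ', k₃, h5⟩ := hS5
  obtain ⟨c, hc, h6⟩ := hS6a
  -- the cut exponent
  set σ : ℝ := 1 / (4 * ((k₂ : ℝ) + 1) ^ 2) with hσdef
  obtain ⟨hσ0, hσ1, hσ2, hσ4, hσkk⟩ := sigma_facts k₂
  -- rates and constants
  set θ₂ : ℝ := min (1 / 4) (σ * κ) with hθ₂def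
  set θ₃ : ℝ := min (1 / 4) (min (σ * κ₃) κ') with hθ₃def
  have hθ₂0 : 0 < θ₂ := lt_min (by norm_num) (by positivity)
  have hθ₂1 : θ₂ ≤ 1 := (min_le_left _ _).trans (by norm_num)
  have hθ₃0 : 0 < θ₃ := lt_min (by norm_num) (lt_min (by positivity) hκ')
  -- the threshold polynomial: `P = K* · L^{q*}` dominates every piece; we ask `b ≥ K*²·L^{2q*+1}`
  set Kst : ℝ := K₂ ^ 2 + K₂ ^ k₂ * (40 + K₅) + (40 + K₅) / c + K₃ + 1 with hKst
  set qst : ℕ := 2 * k₂ + (k₂ * k₂ + 4 + k₅) + (10 + k₅) + k₃ with hqst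
  have hn1 : 0 ≤ K₂ ^ 2 := by positivity
  have hn2 : 0 ≤ K₂ ^ k₂ * (40 + K₅) := by positivity
  have hn3 : 0 ≤ (40 + K₅) / c := by positivity
  have hKst1 : 1 ≤ Kst := by rw [hKst]; linarith only [hn1, hn2, hn3, hK₃]
  have hKa : K₂ ^ 2 ≤ Kst := by rw [hKst]; linarith only [hn1, hn2, hn3, hK₃]
  have hKb : K₂ ^ k₂ * (40 + K₅) ≤ Kst := by rw [hKst]; linarith only [hn1, hn2, hn3, hK₃]
  have hKc : (40 + K₅) / c ≤ Kst := by rw [hKst]; linarith only [hn1, hn2, hn3, hK₃]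
  have hKd : K₃ ≤ Kst := by rw [hKst]; linarith only [hn1, hn2, hn3, hK₃]
  refine ⟨Kst ^ 2, K₂ + 1 + 2 * K₄, 1 + 3 * K₃, θ₂, θ₃, 2 * qst + 1, max k₂ k₄, k₃, 1, by positivity, by positivity, by positivity,
    hθ₂0, hθ₂1, hθ₃0, by omega, le_rfl, fun L _ _ => (h4 L).1, ?_⟩
  intro L _ hL b hb
  -- window facts
  have hL1 : (1 : ℝ) ≤ L := by exact_mod_cast hL
  have hL0 : (0 : ℝ) < L := by linarith
  obtain ⟨hb1, hPhalf, hb_half_34, hb_34_1, hb4⟩ := threshold_facts hKst1 hL1 hb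
  have hb0 : 0 < b := by linarith
  have hP34 : Kst * (L : ℝ) ^ qst ≤ b ^ (3 / 4 : ℝ) := hPhalf.trans hb_half_34
  have hPb : Kst * (L : ℝ) ^ qst ≤ b := hP34.trans hb_34_1
  -- each piece is dominated by `P`
  have hpiece1 : K₂ ^ 2 * (L : ℝ) ^ (2 * k₂) ≤ Kst * (L : ℝ) ^ qst := monomial_dom hL1 hn1 hKa (by omega)
  have hpiece2 : K₂ ^ k₂ * (40 + K₅) * (L : ℝ) ^ (k₂ * k₂ + 4 + k₅) ≤ Kst * (L : ℝ) ^ qst := monomial_dom hL1 hn2 hKb (by omega)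
  have hpiece3 : (40 + K₅) / c * (L : ℝ) ^ (10 + k₅) ≤ Kst * (L : ℝ) ^ qst := monomial_dom hL1 hn3 hKc (by omega)
  have hpiece4 : K₃ * (L : ℝ) ^ k₃ ≤ Kst * (L : ℝ) ^ qst := monomial_dom hL1 hK₃.le hKd (by omega)
  -- the cuts
  set ψ₀ : ℝ := b ^ (-σ) with hψ₀def
  set V₀ : ℝ := b ^ σ with hV₀def
  have hψ0 : 0 < ψ₀ := Real.rpow_pos_of_pos hb0 _
  have hψ1 : ψ₀ ≤ 1 := Real.rpow_le_one_of_one_le_of_nonpos hb1 (by linarith)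
  have hV1 : 1 ≤ V₀ := by
    have h := Real.rpow_le_rpow_of_exponent_le hb1 hσ0.le
    rwa [Real.rpow_zero] at h
  have eVψk : (V₀ / ψ₀) ^ k₂ = b ^ (2 * σ * k₂) := cut_ratio_pow hb0 hψ₀def hV₀def k₂
  have eψκ : ∀ κ₀ : ℝ, ψ₀ ^ κ₀ = b ^ (-(σ * κ₀)) := fun κ₀ => by
    rw [hψ₀def, ← Real.rpow_mul hb0.le]; ring_nf
  have eVκ : ∀ κ₀ : ℝ, V₀ ^ (-κ₀) = b ^ (-(σ * κ₀)) := fun κ₀ => by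
    rw [hV₀def, ← Real.rpow_mul hb0.le]; ring_nf
  -- feed the inputs
  have hT1 : (K₂ * (L : ℝ) ^ k₂ * (V₀ / ψ₀) ^ k₂) ^ 2 ≤ b := sTwo_threshold hb1 hψ₀def hV₀def hσ4 (hpiece1.trans hP34)
  obtain ⟨-, hbulk⟩ := h2 L ψ₀ V₀ b hψ0 hψ1 hV1 hT1
  obtain ⟨h𝔐pos, h4'⟩ := h4 L
  obtain ⟨hdef0, hdef⟩ := h4' ψ₀ V₀ hψ0 hψ1 hV1
  have htip := h5 L ψ₀ V₀ b hψ0 hψ1 hV1 (hpiece4.trans hPb)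
  obtain ⟨hIg, hgc, hbad⟩ := h6 L ψ₀ V₀ b hψ0 hb0.le
  rw [hα L] at hbulk htip
  have hA0 : 0 < (2 * Real.pi / b) ^ (9 * (L : ℝ) ^ 4 - 1) := Real.rpow_pos_of_pos (div_pos Real.two_pi_pos hb0) _
  have hMain0 : 0 < (2 * Real.pi / b) ^ (9 * (L : ℝ) ^ 4 - 1) * mbConst L := mul_pos hA0 h𝔐pos
  -- the exponent data for `exp_absorb`: `e = 9L⁴ − 1 ≤ E = 9L⁴`, `M = K₅ L^{k₅}`
  have hL4 : (1 : ℝ) ≤ (L : ℝ) ^ 4 := one_le_pow₀ hL1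
  have he0 : (0 : ℝ) ≤ 9 * (L : ℝ) ^ 4 - 1 := by linarith
  have heE : 9 * (L : ℝ) ^ 4 - 1 ≤ 9 * (L : ℝ) ^ 4 := by linarith
  have hM0 : 0 ≤ K₅ * (L : ℝ) ^ k₅ := by positivity
  -- (A) the off-tube exponential of S2i, (B) the bad-sign exponential of S6a
  have hexpA : Real.exp (-(b * (ψ₀ / (K₂ * (L : ℝ) ^ k₂ * V₀ ^ k₂)) ^ k₂)) ≤
      b ^ (-(1 / 4 : ℝ)) * ((2 * Real.pi / b) ^ (9 * (L : ℝ) ^ 4 - 1) * mbConst L) :=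
    exp_absorb hb1 he0 heE hM0 (h4b L) (offTube_exponent_le hb1 hL1 hK₂ hK₅ hψ₀def hV₀def hσkk (hpiece2.trans hPhalf))
  have hexpB : Real.exp (-(b * (c / (L : ℝ) ^ 6))) ≤ b ^ (-(1 / 4 : ℝ)) * ((2 * Real.pi / b) ^ (9 * (L : ℝ) ^ 4 - 1) * mbConst L) :=
    exp_absorb hb1 he0 heE hM0 (h4b L) (badSign_exponent_le hb1 hL1 hK₅ hc (hpiece3.trans hP34))
  -- rate comparisons (`b ≥ 1`)
  have hr2 : b ^ (2 * σ * k₂) * b ^ (-(1 / 2 : ℝ)) ≤ b ^ (-θ₂) := by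
    rw [← Real.rpow_add hb0]
    exact Real.rpow_le_rpow_of_exponent_le hb1 (by have := min_le_left (1 / 4 : ℝ) (σ * κ); linarith)
  have hr14_2 : b ^ (-(1 / 4 : ℝ)) ≤ b ^ (-θ₂) := Real.rpow_le_rpow_of_exponent_le hb1 (neg_le_neg (min_le_left _ _))
  have hrκ_2 : b ^ (-(σ * κ)) ≤ b ^ (-θ₂) := Real.rpow_le_rpow_of_exponent_le hb1 (neg_le_neg (min_le_right _ _))
  have hr14_3 : b ^ (-(1 / 4 : ℝ)) ≤ b ^ (-θ₃) := Real.rpow_le_rpow_of_exponent_le hb1 (neg_le_neg (min_le_left _ _))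
  have hrκ_3 : b ^ (-(σ * κ₃)) ≤ b ^ (-θ₃) :=
    Real.rpow_le_rpow_of_exponent_le hb1 (neg_le_neg ((min_le_right _ _).trans (min_le_left _ _)))
  have hrκ'_3 : b ^ (-κ') ≤ b ^ (-θ₃) := Real.rpow_le_rpow_of_exponent_le hb1 (neg_le_neg ((min_le_right _ _).trans (min_le_right _ _)))
  have hbθ₂ : 0 ≤ b ^ (-θ₂) := Real.rpow_nonneg hb0.le _
  have hbθ₃ : 0 ≤ b ^ (-θ₃) := Real.rpow_nonneg hb0.le _
  have hLmax2 : (L : ℝ) ^ k₂ ≤ (L : ℝ) ^ max k₂ k₄ := pow_le_pow_right₀ hL1 (le_max_left _ _)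
  have hLmax4 : (L : ℝ) ^ k₄ ≤ (L : ℝ) ^ max k₂ k₄ := pow_le_pow_right₀ hL1 (le_max_right _ _)
  have hLm24 : (1 : ℝ) ≤ (L : ℝ) ^ max k₂ k₄ := one_le_pow₀ hL1
  have hLm3 : (1 : ℝ) ≤ (L : ℝ) ^ k₃ := one_le_pow₀ hL1
  -- THE DECOMPOSITION `Ib := bulkIntegral`, `R := chart − Ib`
  refine ⟨bulkIntegral L b ψ₀ V₀, chartIntegral L b - bulkIntegral L b ψ₀ V₀, hIg.trans hgc, by linarith, ?_, ?_⟩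
  · -- two-sided: `|Ib − Main| ≤ (r₁ + b^{−1/4} + D)·Main ≤ (K₂ + 1 + 2K₄) L^{max} b^{−θ₂}·Main`
    have hmain := bulk_two_sided hA0.le (by linarith) (by positivity) hbulk hexpA hdef
    refine hmain.trans (mul_le_mul_of_nonneg_right ?_ hMain0.le)
    have i1 : K₂ * (L : ℝ) ^ k₂ * (V₀ / ψ₀) ^ k₂ * b ^ (-(1 / 2 : ℝ)) ≤ K₂ * (L : ℝ) ^ max k₂ k₄ * b ^ (-θ₂) := by
      rw [eVψk, mul_assoc (K₂ * (L : ℝ) ^ k₂)]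
      exact mul_le_mul (mul_le_mul_of_nonneg_left hLmax2 hK₂.le) hr2 (by positivity) (by positivity)
    have i2 : b ^ (-(1 / 4 : ℝ)) ≤ (L : ℝ) ^ max k₂ k₄ * b ^ (-θ₂) := hr14_2.trans (le_mul_of_one_le_left hbθ₂ hLm24)
    have i3 : K₄ * (L : ℝ) ^ k₄ * (ψ₀ ^ κ + V₀ ^ (-κ)) ≤ 2 * K₄ * (L : ℝ) ^ max k₂ k₄ * b ^ (-θ₂) := by
      rw [eψκ, eVκ]
      calc K₄ * (L : ℝ) ^ k₄ * (b ^ (-(σ * κ)) + b ^ (-(σ * κ))) = 2 * K₄ * (L : ℝ) ^ k₄ * b ^ (-(σ * κ)) := by ring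
        _ ≤ 2 * K₄ * (L : ℝ) ^ max k₂ k₄ * b ^ (-θ₂) :=
            mul_le_mul (mul_le_mul_of_nonneg_left hLmax4 (by positivity)) hrκ_2 (Real.rpow_nonneg hb0.le _) (by positivity)
    have e : (K₂ + 1 + 2 * K₄) * (L : ℝ) ^ max k₂ k₄ * b ^ (-θ₂) =
        K₂ * (L : ℝ) ^ max k₂ k₄ * b ^ (-θ₂) + (L : ℝ) ^ max k₂ k₄ * b ^ (-θ₂) + 2 * K₄ * (L : ℝ) ^ max k₂ k₄ * b ^ (-θ₂) := by ring
    rw [e]; linarith only [i1, i2, i3]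
  · -- rest: `R = (chart − good) + (good − Ib) ≤ (b^{−1/4} + 3K₃L^{k₃}b^{−θ₃})·Main ≤ (1 + 3K₃) L^{k₃} b^{−θ₃}·Main`
    have j1 : ψ₀ ^ κ₃ + V₀ ^ (-κ₃) + b ^ (-κ') ≤ 3 * b ^ (-θ₃) := by rw [eψκ, eVκ]; linarith only [hrκ_3, hrκ'_3]
    have j2 : K₃ * (L : ℝ) ^ k₃ * (ψ₀ ^ κ₃ + V₀ ^ (-κ₃) + b ^ (-κ')) * ((2 * Real.pi / b) ^ (9 * (L : ℝ) ^ 4 - 1) * mbConst L) ≤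
        3 * K₃ * (L : ℝ) ^ k₃ * b ^ (-θ₃) * ((2 * Real.pi / b) ^ (9 * (L : ℝ) ^ 4 - 1) * mbConst L) := by
      refine mul_le_mul_of_nonneg_right ?_ hMain0.le
      calc K₃ * (L : ℝ) ^ k₃ * (ψ₀ ^ κ₃ + V₀ ^ (-κ₃) + b ^ (-κ')) ≤ K₃ * (L : ℝ) ^ k₃ * (3 * b ^ (-θ₃)) :=
            mul_le_mul_of_nonneg_left j1 (by positivity)
        _ = 3 * K₃ * (L : ℝ) ^ k₃ * b ^ (-θ₃) := by ring
    have j3 : b ^ (-(1 / 4 : ℝ)) * ((2 * Real.pi / b) ^ (9 * (L : ℝ) ^ 4 - 1) * mbConst L) ≤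
        (L : ℝ) ^ k₃ * b ^ (-θ₃) * ((2 * Real.pi / b) ^ (9 * (L : ℝ) ^ 4 - 1) * mbConst L) :=
      mul_le_mul_of_nonneg_right (hr14_3.trans (le_mul_of_one_le_left hbθ₃ hLm3)) hMain0.le
    have e : (1 + 3 * K₃) * (L : ℝ) ^ k₃ * b ^ (-θ₃) * ((2 * Real.pi / b) ^ (9 * (L : ℝ) ^ 4 - 1) * mbConst L) =
        (L : ℝ) ^ k₃ * b ^ (-θ₃) * ((2 * Real.pi / b) ^ (9 * (L : ℝ) ^ 4 - 1) * mbConst L) +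
          3 * K₃ * (L : ℝ) ^ k₃ * b ^ (-θ₃) * ((2 * Real.pi / b) ^ (9 * (L : ℝ) ^ 4 - 1) * mbConst L) := by ring
    rw [e]; linarith only [hbad, hexpB, htip, j2, j3]

end Summit.QuantumFields.YangMills.Theorems.SwapVirialDeficit.SectorLaplace

end
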